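import Summits.BirchSwinnertonDyer.Rank1Residual.X11b.AtomA1SelmerCertificate
import Summits.BirchSwinnertonDyer.Rank1Residual.AdditivePotMult.RankOneIndexCertificate
import Summits.BirchSwinnertonDyer.Rank1Residual.X2.RankOneHeegner
import Literature.NumberTheory.EllipticCurves.Rank1Residual.Typed.SelmerCardCertificate
import HarnessLib

/-!
# X11b at `p = 3` (and every odd `p`): the `#Ш_an` binder `hq : shaAn W = q` of the T-SEL3 /
# A1 roads DISCHARGED from the EXACT Gross–Zagier index record (cell `b2b-bsdres`, unit `x11b` gen 19)

HONEST FRAMING (cell `b2b-bsdres`, run/shared/lean/b2b/bsd-rank1-residual/, verbatim in every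
file): the goal of the cell is to DELETE the COMBINATION-SHAPED residual classes of the
Birch–Swinnerton-Dyer formula for ALL analytic-rank `≤ 1` elliptic curves over `ℚ` — "full BSD
formula for every rank `≤ 1` curve in class `C`" assembled STRICTLY from published theorems — so
that the rank-`≤ 1` remainder becomes exactly the CONSTRUCTION-SHAPED classes, which are TYPED
(missing-input `Prop`s), NOT attempted. This is not "finishing BSD". X11b (multiplicative `p`,
`r = 1`) and X11 ∧ `r = 1` ∧ `p = 3` stay CONSTRUCTION-SHAPED (referee A R6.2). Per pair; research
route; nothing is booked by this file (the lane certifies, the referee books); no mark / label /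
count moves. THEOREMS ONLY (no definition, no named fact, no `sorry`): two tree theorems are
composed in each declaration, nothing is re-proved.

## What the file does (the "D-a" question of the x11b road, put into the kernel)

The three per-pair kernel roads of record for the X11b@3 rank-one residue classes — (T-SEL3)
`Typed.X11.bsdp_three_of_card_selmerThree_pow`, (A1) `X11b.bsdp_of_classX11b_of_ram_of_padicValRat_shaAn_le`
(certificate-free on (ram) ∧ `p ∤ ∏c_ℓ`), (KOLY) `Typed.bsdp_of_kolyvagin_of_not_dvd_index` — all
carry the binder `hq : shaAn W = (q : ℂ)` with a valuation condition on `q`: an equality between the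
complex number `#Ш(E)_an` of a RANK-ONE curve (a regulator enters) and a rational supplied by the
lane; its admissibility is the standing "D-a" question (EFFICIENCY l.261 (3); unanswered). The tree
already holds the exact Gross–Zagier identity that makes the question moot in the kernel:
multr1-p2's `X11b.exists_shaAn_padicVal_eq_of_heegner` (`BDPRouteShaAn.lean`; Jetchev–Skinner–Wan
2017 (eq:gz for K′) + (eq:tamK), exact at odd `p`):
`ord_p #Ш(E)_an + ord_p q_d + ord_p ∏c_ℓ(E) + 2·ord_p #E^{d_K}(ℚ)_tors = 2·ord_p [E(K):ℤP]`
(`P` the Heegner point of a parametrisation datum with `p ∤ c`, `K` Heegner with `p ∤ #𝓞_K^×`, a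
minimal twist model with `ord_p u = 0`, `q_d = L(E^{d_K},1)/Ω ∈ ℚ` the twist's RANK-ZERO algebraic
central value). So `hq ∧ (ord_p q = 0)` FOLLOWS from finite exact data — `I = [E(K):ℤP]`, `q_d`,
`∏c_ℓ(E)` — tied by ONE integer equation `2·ord_p I = ord_p q_d + ord_p ∏c_ℓ(E)` (the twist's
torsion term vanishes: `E[p]` irreducible). This file composes that identity with each road; every
binder left is a PUBLISHED named fact or an EXACT datum of the kind the lane's Heegner-index records
hold (`bsdN` v4u: `D`, `m = 2I_K/e`, `S_D`; `sel3x5e5/CLOSING_x11b3_5e5.tsv` cols `lane_D`,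
`lane_ord3_IK`; x11b3 `cells/x11b3/E-K6-A1RAM3-UNIT.tsv` col. 25):

* §1 (class-free, any odd `p`, `E[p]` irreducible) `exists_shaAn_padicValRat_eq_of_heegner_of_irr`:
  `#Ш(E)_an = q ∈ ℚ` with `ord_p q = 2·ord_p I − ord_p q_d − ord_p ∏c_ℓ(E)`; corollaries
  `exists_shaAn_unit_of_indexRecord` (record EQUATION ⇒ `ord_p q = 0`) and
  `exists_shaAn_padicValRat_le_zero_of_indexRecord` (record INEQUALITY ⇒ `ord_p q ≤ 0`).
* §2 (T-SELp road, class-free, any odd `p`) `bsdp_of_card_selmerGroup_of_indexRecord`: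
  `r_an = 1`, `#Sel^(p)(E/ℚ) = p`, record equation ⇒ `BSD(E,p)`; binders Gross–Zagier `hGZ`,
  Kolyvagin (qualitative) `hKo`, GZK `hGZK`, modularity `hmod` — NO `hq`.
* §3 (p = 3, X11 vocabulary, conductor level: `w_K = 2` from `d_K < −4`, `ord_3 u = 0` from `3 ‖ N`
  by x11b's `padicValRat_u_eq_zero_of_twist_minimal`) `X11.bsdp_three_of_card_selmerThree_of_indexRecord`
  and the X11b-vocabulary twin at every odd `p`, `ClassX11b.bsdp_of_card_selmerGroup_of_indexRecord`.
* §4 (A1 road, every odd `p`, NO certificate on `Ш`) `ClassX11b.bsdp_of_ram_of_not_dvd_of_indexRecord_le`: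
  X11b ∧ (ram) ∧ `p ∤ ∏c_ℓ` + record inequality `2·ord_p I ≤ ord_p q_d` ⇒ `BSD(E,p)`; the ten
  published binders of the A1 road — NO `hq`.
* §5 (KOLY road) `ClassX11b.bsdp_of_ram_of_indexCertificate`: the reading on X11b ∧ (ram) (so `ρ̄`
  onto, `surj_of_irr_of_ram`) of additive-p1's class-free `AdditivePotMult.bsdp_of_rankOne_of_indexCertificate`
  (`p ∤ I`, `ord_p q_d = 0`, `p ∤ ∏c_ℓ` ⇒ `BSD(E,p)`, McCallum's bound `hB`), `w_K`/`u` discharged.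

WHAT THIS FILE DOES NOT DO: decide the admissibility of `q_d` or of the Manin constant of the datum
as certificate inputs (D-a″, referee A — only `p ∤ c(Dt)` is a binder; Mazur 1978 Cor. 4.1,
`p² ∤ 4N`, is the printed reason it holds for the optimal parametrisation at `3 ‖ N`), certify any
record, book any pair, or touch a label. EVIDENCE pointers (lane data, nothing asserted): the 1 081
E-K6 classes (A1 ∧ (ram) ∧ `3 ∤ #Ш_an(E)`) carry `ord₃ I_K = 1` (1 049) or `2` (32) at the field of
record with `v₃(∏c_ℓ) = 0`, i.e. the record equation `2·ord₃ I_K = ord₃ q_d`; the T-SEL3 rows are the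
19 398 EXACT `#Sel₃` certificates of x11b gen 9–11 and the 797 route-2 records of gen 13–15.

References: [JetchevSkinnerWan2017] §7.3.1, §7.4.1–7.4.2; [GrossZagier1986] V.§2; [McCallumLMS1991] §1;
[GrossLMS1991] Prop. 2.1; [Mazur1978] Cor. 4.1; [Mazur1977] III.§5; [Serre1972] Prop. 15;
[SilvermanAEC2009] X.4.2; [Miller2011LMS] §1, Def. 1.1, §4; [GrigorovJorzaPatrikisSteinTarnita2009] §3.
-/

noncomputable section

open scoped Classical

open WeierstrassCurve NumberField Literature.NumberTheory.EllipticCurves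
  Literature.NumberTheory.EllipticCurves.ModularForms
  Literature.NumberTheory.EllipticCurves.Rank1Residual
  Literature.NumberTheory.EllipticCurves.Rank1Residual.Typed
  Literature.NumberTheory.EllipticCurves.KrizLi2019
  Literature.NumberTheory.QuadraticFields

namespace Summit.BirchSwinnertonDyer.Rank1Residual.X11b

/-! ### §1. The valuation of `#Ш(E)_an` from the exact index record (class-free, any odd `p`) -/

section Record

variable (W : WeierstrassCurve ℚ) [W.IsElliptic] [W.IsGloballyMinimal] (p : ℕ) [Fact p.Prime]
  (N : ℕ) [NeZero N] (K : Type) [Field K] [NumberField K]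
  (Dt : ModularParametrizationData W N) (H : HeegnerDatum N (NumberField.discr K)) (ι : K →+* ℂ)
  (P : (W.baseChange K).toAffine.Point)

/-- **`ord_p #Ш(E)_an` READ OFF the exact index record, rank one, any odd `p`, `E[p]` irreducible.**
Data as in `X11b.exists_shaAn_padicVal_eq_of_heegner` (`W/ℚ` globally minimal, `ord_{s=1} L(E,s) = 1`;
`K` imaginary quadratic with the Heegner hypothesis for the level `N`; `P` the Heegner point of a
parametrisation datum `Dt` with `p ∤ c(Dt)`; `p` odd, `p ∤ #𝓞_K^×`; `Wd = Cd • W^{(d_K)}` a globally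
minimal twist model with `ord_p u = 0`; the twist's algebraic central value `q_d ≠ 0`, a datum) plus
`E[p]` irreducible. CONCLUSION: `#Ш(E)_an = q ∈ ℚ` with
`ord_p q = 2·ord_p [E(K):ℤP] − ord_p q_d − ord_p ∏_ℓ c_ℓ(E)` — the host identity with the twist's
torsion term removed (`Wd[p]` irreducible by `hasIrreducibleModPGaloisRep_twist_model`, hence
`p ∤ #Wd(ℚ)_tors`, Mazur). PUBLISHED binders `hGZ`, `hKo`, `hGZK`, `hmod`. Per pair; nothing booked.
[cite: JetchevSkinnerWan2017, §7.4.1 (eq:gz for K′) and §7.3.1 (eq:tamK), pp. 29–30]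
[cite: GrossZagier1986, V.§2 (pp. 310–312)] [cite: Mazur1977, Ch. III §5, p. 157] -/
theorem exists_shaAn_padicValRat_eq_of_heegner_of_irr
    (hGZ : gross_zagier N W K) (hKo : kolyvagin N W K)
    (hGZK : rank_eq_analyticRank_of_analyticRank_le_one) (hmod : hasEntireLFunction_rat)
    (hK : IsImaginaryQuadratic K) (hHN : SatisfiesHeegnerHypothesis N K)
    (hP : WeierstrassCurve.Affine.Point.map ι.toRatAlgHom P = heegnerPointComplex Dt H)
    (hp2 : p ≠ 2) (hc : ¬ (p : ℤ) ∣ Dt.c) (hμ : ¬ p ∣ Units.torsionOrder K)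
    (hr : W.analyticRank = 1) (hirr : Irr W p)
    (Wd : WeierstrassCurve ℚ) [Wd.IsElliptic] [Wd.IsGloballyMinimal] (Cd : VariableChange ℚ)
    (hWd : Cd • W.quadraticTwist (NumberField.discr K : ℚ) = Wd)
    (hu : padicValRat p (Cd.u : ℚ) = 0)
    (qd : ℚ) (hqd : Wd.entireLFunction 1 / (Wd.realPeriodRat : ℂ) = (qd : ℂ)) (hqd0 : qd ≠ 0) :
    ∃ q : ℚ, shaAn W = (q : ℂ) ∧
      padicValRat p q = 2 * (padicValNat p (AddSubgroup.zmultiples P).index : ℤ) -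
        padicValRat p qd - padicValNat p W.tamagawaProduct := by
  have hD0 : (NumberField.discr K : ℚ) ≠ 0 := by exact_mod_cast NumberField.discr_ne_zero K
  haveI hEt : (W.quadraticTwist (NumberField.discr K : ℚ)).IsElliptic :=
    W.isElliptic_quadraticTwist hD0
  -- the twist's central value is non-zero (`q_d ≠ 0`)
  have hLt' : (W.quadraticTwist (NumberField.discr K : ℚ)).entireLFunction = Wd.entireLFunction := by
    rw [← hWd, entireLFunction_smul]
  have hLt : (W.quadraticTwist (NumberField.discr K : ℚ)).entireLFunction 1 ≠ 0 := by
    rw [hLt']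
    intro h0
    apply hqd0
    have : ((qd : ℂ)) = 0 := by rw [← hqd, h0, zero_div]
    exact_mod_cast this
  -- the twist has no rational `p`-torsion
  have hirrd : Wd.HasIrreducibleModPGaloisRep p :=
    hasIrreducibleModPGaloisRep_twist_model W p K hK.1 hirr Cd hWd
  have htors : padicValNat p Wd.torsionOrder = 0 :=
    padicValNat_torsionOrder_eq_zero_of_irreducible Wd p hirrd
  -- the Gross–Zagier bookkeeping identity
  obtain ⟨-, -, -, q, hq, hid⟩ :=
    exists_shaAn_padicVal_eq_of_heegner W p N K Dt H ι P hGZ hKo hGZK hmod hK hHN hP hp2 hc hμ hr hLt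
      Wd Cd hWd hu qd hqd
  refine ⟨q, hq, ?_⟩
  simp only [htors, mul_zero, Nat.cast_zero, add_zero] at hid
  linarith

/-- **The record EQUATION gives the unit binder**: `2·ord_p [E(K):ℤP] = ord_p q_d + ord_p ∏_ℓ c_ℓ(E)`
(integers) ⇒ `#Ш(E)_an = q ∈ ℚ` with `ord_p q = 0` — the pair `(hq, hv)` of the T-SELp consumers.
Per pair. [cite: JetchevSkinnerWan2017, §7.4.1 (eq:gz for K′), pp. 29–30] [cite: Miller2011LMS, §1 and Def. 1.1] -/
theorem exists_shaAn_unit_of_indexRecord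
    (hGZ : gross_zagier N W K) (hKo : kolyvagin N W K)
    (hGZK : rank_eq_analyticRank_of_analyticRank_le_one) (hmod : hasEntireLFunction_rat)
    (hK : IsImaginaryQuadratic K) (hHN : SatisfiesHeegnerHypothesis N K)
    (hP : WeierstrassCurve.Affine.Point.map ι.toRatAlgHom P = heegnerPointComplex Dt H)
    (hp2 : p ≠ 2) (hc : ¬ (p : ℤ) ∣ Dt.c) (hμ : ¬ p ∣ Units.torsionOrder K)
    (hr : W.analyticRank = 1) (hirr : Irr W p)
    (Wd : WeierstrassCurve ℚ) [Wd.IsElliptic] [Wd.IsGloballyMinimal] (Cd : VariableChange ℚ)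
    (hWd : Cd • W.quadraticTwist (NumberField.discr K : ℚ) = Wd)
    (hu : padicValRat p (Cd.u : ℚ) = 0)
    (qd : ℚ) (hqd : Wd.entireLFunction 1 / (Wd.realPeriodRat : ℂ) = (qd : ℂ)) (hqd0 : qd ≠ 0)
    (hrec : 2 * (padicValNat p (AddSubgroup.zmultiples P).index : ℤ) =
      padicValRat p qd + padicValNat p W.tamagawaProduct) :
    ∃ q : ℚ, shaAn W = (q : ℂ) ∧ padicValRat p q = 0 := by
  obtain ⟨q, hq, hv⟩ := exists_shaAn_padicValRat_eq_of_heegner_of_irr W p N K Dt H ι P hGZ hKo hGZK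
    hmod hK hHN hP hp2 hc hμ hr hirr Wd Cd hWd hu qd hqd hqd0
  exact ⟨q, hq, by rw [hv]; linarith⟩

/-- **The record INEQUALITY gives the non-positive binder**: `2·ord_p [E(K):ℤP] ≤ ord_p q_d + ord_p ∏_ℓ c_ℓ(E)`
⇒ `#Ш(E)_an = q ∈ ℚ` with `ord_p q ≤ 0` — the pair `(hq, hv)` of the A1 consumer. Per pair.
[cite: JetchevSkinnerWan2017, §7.4.1 (eq:gz for K′), pp. 29–30] [cite: Miller2011LMS, §1 and Def. 1.1] -/
theorem exists_shaAn_padicValRat_le_zero_of_indexRecord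
    (hGZ : gross_zagier N W K) (hKo : kolyvagin N W K)
    (hGZK : rank_eq_analyticRank_of_analyticRank_le_one) (hmod : hasEntireLFunction_rat)
    (hK : IsImaginaryQuadratic K) (hHN : SatisfiesHeegnerHypothesis N K)
    (hP : WeierstrassCurve.Affine.Point.map ι.toRatAlgHom P = heegnerPointComplex Dt H)
    (hp2 : p ≠ 2) (hc : ¬ (p : ℤ) ∣ Dt.c) (hμ : ¬ p ∣ Units.torsionOrder K)
    (hr : W.analyticRank = 1) (hirr : Irr W p)
    (Wd : WeierstrassCurve ℚ) [Wd.IsElliptic] [Wd.IsGloballyMinimal] (Cd : VariableChange ℚ)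
    (hWd : Cd • W.quadraticTwist (NumberField.discr K : ℚ) = Wd)
    (hu : padicValRat p (Cd.u : ℚ) = 0)
    (qd : ℚ) (hqd : Wd.entireLFunction 1 / (Wd.realPeriodRat : ℂ) = (qd : ℂ)) (hqd0 : qd ≠ 0)
    (hrec : 2 * (padicValNat p (AddSubgroup.zmultiples P).index : ℤ) ≤
      padicValRat p qd + padicValNat p W.tamagawaProduct) :
    ∃ q : ℚ, shaAn W = (q : ℂ) ∧ padicValRat p q ≤ 0 := by
  obtain ⟨q, hq, hv⟩ := exists_shaAn_padicValRat_eq_of_heegner_of_irr W p N K Dt H ι P hGZ hKo hGZK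
    hmod hK hHN hP hp2 hc hμ hr hirr Wd Cd hWd hu qd hqd hqd0
  exact ⟨q, hq, by rw [hv]; linarith⟩

/-! ### §2. The T-SELp road without `hq` (class-free, any odd `p`) -/

/-- **`BSD(E,p)` in rank one from ONE exact `p`-descent and the exact index record — no `#Ш_an`
binder.** Data as in §1 (any odd `p`, `E[p]` irreducible); CERTIFICATES: `#Sel^(p)(E/ℚ) = p`
(so `Ш(E/ℚ)[p] = 0`, `Typed.noPTorsion_of_card_selmerGroup_eq_pow_rank`, rank `= r_an = 1` by GZK)
and the record equation `2·ord_p [E(K):ℤP] = ord_p q_d + ord_p ∏_ℓ c_ℓ(E)` (so `ord_p #Ш(E)_an = 0`,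
§1). Then `Typed.bsdp_of_card_selmerGroup_eq_pow_analyticRank` concludes. PUBLISHED binders: `hGZ`,
`hKo`, `hGZK`, `hmod`. Per pair; not a class theorem; nothing booked.
[cite: Miller2011LMS, §1 and Def. 1.1] [cite: SilvermanAEC2009, Thm. X.4.2 (a)]
[cite: JetchevSkinnerWan2017, §7.4.1 (eq:gz for K′), pp. 29–30] -/
theorem bsdp_of_card_selmerGroup_of_indexRecord
    (hGZ : gross_zagier N W K) (hKo : kolyvagin N W K)
    (hGZK : rank_eq_analyticRank_of_analyticRank_le_one) (hmod : hasEntireLFunction_rat)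
    (hK : IsImaginaryQuadratic K) (hHN : SatisfiesHeegnerHypothesis N K)
    (hP : WeierstrassCurve.Affine.Point.map ι.toRatAlgHom P = heegnerPointComplex Dt H)
    (hp2 : p ≠ 2) (hc : ¬ (p : ℤ) ∣ Dt.c) (hμ : ¬ p ∣ Units.torsionOrder K)
    (hr : W.analyticRank = 1) (hirr : Irr W p)
    (Wd : WeierstrassCurve ℚ) [Wd.IsElliptic] [Wd.IsGloballyMinimal] (Cd : VariableChange ℚ)
    (hWd : Cd • W.quadraticTwist (NumberField.discr K : ℚ) = Wd)
    (hu : padicValRat p (Cd.u : ℚ) = 0)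
    (qd : ℚ) (hqd : Wd.entireLFunction 1 / (Wd.realPeriodRat : ℂ) = (qd : ℂ)) (hqd0 : qd ≠ 0)
    (hcard : Nat.card (W.selmerGroup (p : ℤ)) = p)
    (hrec : 2 * (padicValNat p (AddSubgroup.zmultiples P).index : ℤ) =
      padicValRat p qd + padicValNat p W.tamagawaProduct) :
    BSDp W p := by
  obtain ⟨q, hq, hv⟩ := exists_shaAn_unit_of_indexRecord W p N K Dt H ι P hGZ hKo hGZK hmod hK hHN
    hP hp2 hc hμ hr hirr Wd Cd hWd hu qd hqd hqd0 hrec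
  exact bsdp_of_card_selmerGroup_eq_pow_analyticRank W p hGZK (le_of_eq hr) hq hv
    (by rw [hr, pow_one]; exact hcard)

end Record

/-! ### §3. Conductor level: `w_K = 2` and `ord_p u = 0` discharged (X11b / X11 at `3`) -/

section Conductor

variable (W : WeierstrassCurve ℚ) [W.IsElliptic] [W.IsGloballyMinimal] (p : ℕ) [Fact p.Prime]
  [NeZero (W.conductorNorm ℤ)] (K : Type) [Field K] [NumberField K]
  (Dt : ModularParametrizationData W (W.conductorNorm ℤ))
  (H : HeegnerDatum (W.conductorNorm ℤ) (NumberField.discr K)) (ι : K →+* ℂ)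
  (P : (W.baseChange K).toAffine.Point)

/-- **X11b (`r_an = 1`, `p` odd, multiplicative at `p`, `E[p]` irreducible), every odd `p`:
`BSD(E,p)` from ONE exact `p`-descent `#Sel^(p)(E/ℚ) = p` and the exact index record at a Heegner
field with `d_K < −4` — no `#Ш_an` binder.** §2 at the conductor level: `p ∤ w_K = 2`, and
`ord_p u(Cd) = 0` for the minimal twist model because `p ‖ N` splits in `K`
(`padicValRat_u_eq_zero_of_twist_minimal`). PUBLISHED binders `hGZ`, `hKo`, `hGZK`, `hmod`; the
Manin binder `p ∤ c(Dt)` stays displayed. Per pair; X11b's label unchanged; nothing booked.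
[cite: Miller2011LMS, §1 and Def. 1.1] [cite: JetchevSkinnerWan2017, §7.4.1 (eq:gz for K′), pp. 29–30]
[cite: SilvermanAEC2009, Thm. X.4.2 (a)] -/
theorem ClassX11b.bsdp_of_card_selmerGroup_of_indexRecord
    (hGZ : gross_zagier (W.conductorNorm ℤ) W K) (hKo : kolyvagin (W.conductorNorm ℤ) W K)
    (hGZK : rank_eq_analyticRank_of_analyticRank_le_one) (hmod : hasEntireLFunction_rat)
    (hX : ClassX11b W p)
    (hK : IsImaginaryQuadratic K) (hdK : NumberField.discr K < -4)
    (hHN : SatisfiesHeegnerHypothesis (W.conductorNorm ℤ) K)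
    (hP : WeierstrassCurve.Affine.Point.map ι.toRatAlgHom P = heegnerPointComplex Dt H)
    (hc : ¬ (p : ℤ) ∣ Dt.c)
    (Wd : WeierstrassCurve ℚ) [Wd.IsElliptic] [Wd.IsGloballyMinimal] (Cd : VariableChange ℚ)
    (hWd : Cd • W.quadraticTwist (NumberField.discr K : ℚ) = Wd)
    (qd : ℚ) (hqd : Wd.entireLFunction 1 / (Wd.realPeriodRat : ℂ) = (qd : ℂ)) (hqd0 : qd ≠ 0)
    (hcard : Nat.card (W.selmerGroup (p : ℤ)) = p)
    (hrec : 2 * (padicValNat p (AddSubgroup.zmultiples P).index : ℤ) =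
      padicValRat p qd + padicValNat p W.tamagawaProduct) :
    BSDp W p := by
  obtain ⟨hr, hp2, hmult, hirr⟩ := hX
  have hμ : ¬ p ∣ Units.torsionOrder K := X2.not_dvd_unitsTorsionOrder_of_discr_lt hK hdK Fact.out hp2
  have hu : padicValRat p (Cd.u : ℚ) = 0 :=
    padicValRat_u_eq_zero_of_twist_minimal W p K hK hHN hmult Cd hWd
  exact X11b.bsdp_of_card_selmerGroup_of_indexRecord W p (W.conductorNorm ℤ) K Dt H ι P hGZ hKo hGZK
    hmod hK hHN hP hp2 hc hμ hr hirr Wd Cd hWd hu qd hqd hqd0 hcard hrec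

/-- **X11 at `p = 3`, rank one (the T-SEL3 rows of record): `BSD(E,3)` from the EXACT `3`-descent
`#Sel^(3)(E/ℚ) = 3` and the exact index record — the consumer `Typed.X11.bsdp_three_of_card_selmerThree_pow`
with its binders `hq`/`hv` REPLACED by the record equation `2·ord₃ [E(K):ℤP] = ord₃ q_d + ord₃ ∏c_ℓ(E)`.**
Pair: `ClassX11 W 3` (multiplicative at `3`, `E[3]` irreducible) with `r_an = 1`; Heegner field with
`d_K < −4` and the Heegner hypothesis for `N_E`; parametrisation datum at level `N_E` with `3 ∤ c`
(displayed; Mazur 1978 Cor. 4.1 is why it holds for the optimal curve at `3 ‖ N`). PUBLISHED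
binders: Gross–Zagier `hGZ`, Kolyvagin `hKo`, GZK `hGZK`, modularity `hmod`. Per pair; X11 ∧ `r = 1`
∧ `p = 3` stays CONSTRUCTION-SHAPED as a class; nothing booked.
[cite: Miller2011LMS, §1 and Def. 1.1] [cite: JetchevSkinnerWan2017, §7.4.1 (eq:gz for K′), pp. 29–30]
[cite: Mazur1978, Cor. 4.1] -/
theorem X11.bsdp_three_of_card_selmerThree_of_indexRecord
    (hGZ : gross_zagier (W.conductorNorm ℤ) W K) (hKo : kolyvagin (W.conductorNorm ℤ) W K)
    (hGZK : rank_eq_analyticRank_of_analyticRank_le_one) (hmod : hasEntireLFunction_rat)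
    (hX : ClassX11 W 3) (hr : W.analyticRank = 1)
    (hK : IsImaginaryQuadratic K) (hdK : NumberField.discr K < -4)
    (hHN : SatisfiesHeegnerHypothesis (W.conductorNorm ℤ) K)
    (hP : WeierstrassCurve.Affine.Point.map ι.toRatAlgHom P = heegnerPointComplex Dt H)
    (hc : ¬ (3 : ℤ) ∣ Dt.c)
    (Wd : WeierstrassCurve ℚ) [Wd.IsElliptic] [Wd.IsGloballyMinimal] (Cd : VariableChange ℚ)
    (hWd : Cd • W.quadraticTwist (NumberField.discr K : ℚ) = Wd)
    (qd : ℚ) (hqd : Wd.entireLFunction 1 / (Wd.realPeriodRat : ℂ) = (qd : ℂ)) (hqd0 : qd ≠ 0)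
    (hcard : Nat.card (W.selmerGroup (3 : ℤ)) = 3)
    (hrec : 2 * (padicValNat 3 (AddSubgroup.zmultiples P).index : ℤ) =
      padicValRat 3 qd + padicValNat 3 W.tamagawaProduct) :
    BSDp W 3 :=
  ClassX11b.bsdp_of_card_selmerGroup_of_indexRecord W 3 K Dt H ι P hGZ hKo hGZK hmod
    ⟨hr, by decide, hX.1, hX.2.1⟩ hK hdK hHN hP (by exact_mod_cast hc) Wd Cd hWd qd hqd hqd0
    (by exact_mod_cast hcard) hrec

/-! ### §4. The A1 road (`(ram) ∧ p ∤ ∏c_ℓ`), every odd `p`: NO certificate on `Ш`, no `hq` -/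

/-- **X11b ∧ (ram) ∧ `p ∤ ∏c_ℓ`, EVERY ODD PRIME: `BSD(E,p)` from the ten PUBLISHED facts of the A1
road and the exact index record ALONE** — `bsdp_of_classX11b_of_ram_of_padicValRat_shaAn_le` with
`hq`/`hv : ord_p #Ш(E)_an ≤ 0` REPLACED by the record inequality `2·ord_p [E(K):ℤP] ≤ ord_p q_d` at a
Heegner field with `d_K < −4` (§1; `p ∤ ∏c_ℓ` removes the Tamagawa term; `w_K`, `u` discharged as in
§3). No descent certificate, no `#Ш_an` value: the unconditional Euler-system half bounds
`ord_p #Ш(E)` by `ord_p #Ш(E)_an ≤ 0`. PUBLISHED binders: `hGZ hKo hB hSk hGZK hmod hnf hHL hMaz hNS`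
(Gross–Zagier, Kolyvagin Thm. A + McCallum's bound, Skinner 2016 Thm. C for the Hoffstein–Luo twist,
GZK, modularity ×2, Hoffstein–Luo 1997, Mazur 1978 Cor. 4.1, Néron). Per pair; nothing booked.
[cite: JetchevSkinnerWan2017, §7.4.2 (p. 31)] [cite: McCallumLMS1991, §1 Theorem (Kolyvagin), p. 296]
[cite: Skinner2016PacificMC, Thm. C (§1) and footnote 1] [cite: Miller2011LMS, §1 and Def. 1.1] -/
theorem ClassX11b.bsdp_of_ram_of_not_dvd_of_indexRecord_le
    (hGZ : ∀ (N : ℕ) [NeZero N] (W : WeierstrassCurve ℚ) (K : Type) [Field K] [NumberField K],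
      gross_zagier N W K)
    (hKo : ∀ (N : ℕ) [NeZero N] (W : WeierstrassCurve ℚ) (K : Type) [Field K] [NumberField K],
      kolyvagin N W K)
    (hB : ∀ (N : ℕ) [NeZero N] (W : WeierstrassCurve ℚ) (K : Type) [Field K] [NumberField K],
      Kolyvagin1990_padicValNat_card_sha_le N W K)
    (hSk : Skinner2016.thmC_padicValRat_bsd_rank_zero)
    (hGZK : rank_eq_analyticRank_of_analyticRank_le_one) (hmod : hasEntireLFunction_rat)
    (hnf : exists_isNewformOf) (hHL : HoffsteinLuo1997_exists_twist_L_one_ne_zero)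
    (hMaz : mazur_not_dvd_maninConstant_of_odd) (hNS : integral_neronScaling_of_isGloballyMinimal)
    (hX : ClassX11b W p) (hram : Ram W p) (htam0 : ¬ p ∣ W.tamagawaProduct)
    (hK : IsImaginaryQuadratic K) (hdK : NumberField.discr K < -4)
    (hHN : SatisfiesHeegnerHypothesis (W.conductorNorm ℤ) K)
    (hP : WeierstrassCurve.Affine.Point.map ι.toRatAlgHom P = heegnerPointComplex Dt H)
    (hc : ¬ (p : ℤ) ∣ Dt.c)
    (Wd : WeierstrassCurve ℚ) [Wd.IsElliptic] [Wd.IsGloballyMinimal] (Cd : VariableChange ℚ)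
    (hWd : Cd • W.quadraticTwist (NumberField.discr K : ℚ) = Wd)
    (qd : ℚ) (hqd : Wd.entireLFunction 1 / (Wd.realPeriodRat : ℂ) = (qd : ℂ)) (hqd0 : qd ≠ 0)
    (hrec : 2 * (padicValNat p (AddSubgroup.zmultiples P).index : ℤ) ≤ padicValRat p qd) :
    BSDp W p := by
  obtain ⟨hr, hp2, hmult, hirr⟩ := hX
  have hμ : ¬ p ∣ Units.torsionOrder K := X2.not_dvd_unitsTorsionOrder_of_discr_lt hK hdK Fact.out hp2
  have hu : padicValRat p (Cd.u : ℚ) = 0 :=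
    padicValRat_u_eq_zero_of_twist_minimal W p K hK hHN hmult Cd hWd
  have htam : padicValNat p W.tamagawaProduct = 0 := padicValNat.eq_zero_of_not_dvd htam0
  obtain ⟨q, hq, hv⟩ := exists_shaAn_padicValRat_le_zero_of_indexRecord W p (W.conductorNorm ℤ) K Dt
    H ι P (hGZ _ W K) (hKo _ W K) hGZK hmod hK hHN hP hp2 hc hμ hr hirr Wd Cd hWd hu qd hqd hqd0
    (by rw [htam, Nat.cast_zero, add_zero]; exact hrec)
  exact bsdp_of_classX11b_of_ram_of_padicValRat_shaAn_le hGZ hKo hB hSk hGZK hmod hnf hHL hMaz hNS W p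
    ⟨hr, hp2, hmult, hirr⟩ hram htam0 hq hv

/-- **The `p = 3` reading in the vocabulary of `IsX11Three`** (`Rank1Residual/X11Three.lean`): on
(ram) ∧ `3 ∤ ∏c_ℓ` the exact index record with `2·ord₃ [E(K):ℤP] ≤ ord₃ q_d` gives `BSD(E,3)` from
the ten published facts — the E-K6 row shape (`ord₃ I_K ∈ {1,2}`, `ord₃ q_d = 2·ord₃ I_K`). Per pair;
X11 ∧ `r = 1` ∧ `p = 3` stays CONSTRUCTION-SHAPED; nothing booked.
[cite: JetchevSkinnerWan2017, §7.4.2 (p. 31)] [cite: Miller2011LMS, §1 and Def. 1.1] -/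
theorem IsX11Three.bsdp_of_ram_of_not_dvd_of_indexRecord_le
    (hGZ : ∀ (N : ℕ) [NeZero N] (W : WeierstrassCurve ℚ) (K : Type) [Field K] [NumberField K],
      gross_zagier N W K)
    (hKo : ∀ (N : ℕ) [NeZero N] (W : WeierstrassCurve ℚ) (K : Type) [Field K] [NumberField K],
      kolyvagin N W K)
    (hB : ∀ (N : ℕ) [NeZero N] (W : WeierstrassCurve ℚ) (K : Type) [Field K] [NumberField K],
      Kolyvagin1990_padicValNat_card_sha_le N W K)
    (hSk : Skinner2016.thmC_padicValRat_bsd_rank_zero)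
    (hGZK : rank_eq_analyticRank_of_analyticRank_le_one) (hmod : hasEntireLFunction_rat)
    (hnf : exists_isNewformOf) (hHL : HoffsteinLuo1997_exists_twist_L_one_ne_zero)
    (hMaz : mazur_not_dvd_maninConstant_of_odd) (hNS : integral_neronScaling_of_isGloballyMinimal)
    (hX : IsX11Three W) (hram : Ram W 3) (htam0 : ¬ 3 ∣ W.tamagawaProduct)
    (hK : IsImaginaryQuadratic K) (hdK : NumberField.discr K < -4)
    (hHN : SatisfiesHeegnerHypothesis (W.conductorNorm ℤ) K)
    (hP : WeierstrassCurve.Affine.Point.map ι.toRatAlgHom P = heegnerPointComplex Dt H)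
    (hc : ¬ (3 : ℤ) ∣ Dt.c)
    (Wd : WeierstrassCurve ℚ) [Wd.IsElliptic] [Wd.IsGloballyMinimal] (Cd : VariableChange ℚ)
    (hWd : Cd • W.quadraticTwist (NumberField.discr K : ℚ) = Wd)
    (qd : ℚ) (hqd : Wd.entireLFunction 1 / (Wd.realPeriodRat : ℂ) = (qd : ℂ)) (hqd0 : qd ≠ 0)
    (hrec : 2 * (padicValNat 3 (AddSubgroup.zmultiples P).index : ℤ) ≤ padicValRat 3 qd) :
    BSDp W 3 :=
  ClassX11b.bsdp_of_ram_of_not_dvd_of_indexRecord_le W 3 K Dt H ι P hGZ hKo hB hSk hGZK hmod hnf hHL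
    hMaz hNS (classX11b_three_of_isX11Three W hX) hram htam0 hK hdK hHN hP (by exact_mod_cast hc) Wd Cd
    hWd qd hqd hqd0 hrec

/-! ### §5. The KOLY road on X11b ∧ (ram): the index CERTIFICATE (`p ∤ I`) closes outright -/

/-- **X11b ∧ (ram), every odd `p`: `BSD(E,p)` from the exact index certificate `p ∤ [E(K):ℤP]`,
`ord_p q_d = 0`, `p ∤ ∏c_ℓ(E)` — additive-p1's class-free `AdditivePotMult.bsdp_of_rankOne_of_indexCertificate`
read on X11b**, where `ρ̄_{E,p}` is onto by `surj_of_irr_of_ram` (Serre Prop. 15) and `w_K`, `u` are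
discharged as in §3. This is the kernel consumer of the "Kolyvagin rescue" fields of
`HOME/b2b-bsdres-x11b/koly/KOLY_RESCUE_table.tsv` (X11B-AUDIT §17.3) WITHOUT an `#Ш_an` binder.
PUBLISHED binders: `hGZ`, `hKo`, McCallum's bound `hB`, `hGZK`, `hmod`. Per pair; nothing booked.
[cite: McCallumLMS1991, §1 Theorem (Kolyvagin), p. 296] [cite: GrossLMS1991, §2 Prop. 2.1 (2)]
[cite: Serre1972, §2.4 Prop. 15] [cite: Miller2011LMS, §1 and Def. 1.1] -/
theorem ClassX11b.bsdp_of_ram_of_indexCertificate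
    (hGZ : gross_zagier (W.conductorNorm ℤ) W K) (hKo : kolyvagin (W.conductorNorm ℤ) W K)
    (hB : Kolyvagin1990_padicValNat_card_sha_le (W.conductorNorm ℤ) W K)
    (hGZK : rank_eq_analyticRank_of_analyticRank_le_one) (hmod : hasEntireLFunction_rat)
    (hX : ClassX11b W p) (hram : Ram W p)
    (hK : IsImaginaryQuadratic K) (hdK : NumberField.discr K < -4)
    (hHN : SatisfiesHeegnerHypothesis (W.conductorNorm ℤ) K)
    (hP : WeierstrassCurve.Affine.Point.map ι.toRatAlgHom P = heegnerPointComplex Dt H)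
    (hc : ¬ (p : ℤ) ∣ Dt.c)
    (Wd : WeierstrassCurve ℚ) [Wd.IsElliptic] [Wd.IsGloballyMinimal] (Cd : VariableChange ℚ)
    (hWd : Cd • W.quadraticTwist (NumberField.discr K : ℚ) = Wd)
    (qd : ℚ) (hqd : Wd.entireLFunction 1 / (Wd.realPeriodRat : ℂ) = (qd : ℂ)) (hqd0 : qd ≠ 0)
    (hvd : padicValRat p qd = 0) (hI : ¬ p ∣ (AddSubgroup.zmultiples P).index)
    (htam : ¬ p ∣ W.tamagawaProduct) :
    BSDp W p := by
  obtain ⟨hr, hp2, hmult, hirr⟩ := hX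
  have hsurj : Surj W p := surj_of_irr_of_ram W p hirr hram
  have hμ : ¬ p ∣ Units.torsionOrder K := X2.not_dvd_unitsTorsionOrder_of_discr_lt hK hdK Fact.out hp2
  have hu : padicValRat p (Cd.u : ℚ) = 0 :=
    padicValRat_u_eq_zero_of_twist_minimal W p K hK hHN hmult Cd hWd
  exact AdditivePotMult.bsdp_of_rankOne_of_indexCertificate W p (W.conductorNorm ℤ) K Dt H ι P hGZ
    hKo hB hGZK hmod hK hHN hP hp2 hc hμ hr hsurj Wd Cd hWd hu qd hqd hqd0 hvd hI htam

end Conductor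

end Summit.BirchSwinnertonDyer.Rank1Residual.X11b

end
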